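import Summits.QuantumFields.YangMills.Theorems.QuantileBitRingTraceDefs
import Summits.QuantumFields.YangMills.Theorems.SlowBitWindowPersistenceChain
import HarnessLib

/-!
# The closed ring of `n+1` transfer kernels: slice weights, their monotonicity and additivity, and the one-step persistence bound
# `ringInsTrace L β n O 1 ≥ Z_phys(n+1) − 2·ringInsTrace L β n 𝟙_A 0 − 2·e^{β(2|E| − t²/2)}·(e^{2β|E|})^{n}`

Support module for the door `QuantileBitPurity.QuantileBitDoor` (item stmt-QuantumFields-23925, LINE g12-B of seat ym-idea-4; target leaf
`ThermalTraceWindow.SubFemtoTraceRatio`).  The ring-length-general copy of `SlowBitWindowPersistenceChain` (which treats the `2L`-ring `insTrace`):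
for the two-insertion ring trace `TT.ringInsTrace L β n O m` (p682813; `n+1` bond kernels, `n` copies of `K_β` and the seam `K_β^P`, `O` inserted at
slices `0` and `m`) we prove, directly on the slice space and WITHOUT spectral input,

* §1 the ring as a function on `Fin (n+1) → GaugeConfig 3 L SU2`: measurable, non-negative, bounded by `(e^{2β|E|})^{n}·e^{2β|E|}`; the slice-`0`
  weight `ringInsTrace L β n 𝟙_A 0 = ∫ ring·𝟙_A(U₀)` (the un-normalised thermal weight of a slice event at temperature `1/(n+1)`), its
  non-negativity, monotonicity and subadditivity in `A`, complement additivity `weight(A) + weight(Aᶜ) = Z_phys(n+1)`, and the two-time bound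
  `ringInsTrace L β n 𝟙_A m ≤ ringInsTrace L β n 𝟙_A 0`;
* §2 ★ `ringInsTrace_one_ge_of_persistence`: if a measurable `O` with `|O| ≤ 1` satisfies the POINTWISE persistence inequality
  `O(U)O(V) ≥ 1 − 2·𝟙_A(U) − 2·𝟙[some link of (U,V) is t-far]`, then
  `ringInsTrace L β n O 1 ≥ Z_phys(n+1) − 2·ringInsTrace L β n 𝟙_A 0 − 2·e^{β(2|E|−t²/2)}(e^{2β|E|})^{n−1}e^{2β|E|}` (`n ≥ 1`).

HONEST FRAMING: fixed-lattice bookkeeping for a reduction (door); no semiclassics/RG; nothing about infinite volume, the continuum limit or the Clay gap.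
No `sorry`, no new axiom, no new definition.  References: [cite: MadrasSokal1988, §2]; [cite: MontvayMunster1994, (3.145)]; [cite: SeilerLNP1982, §3].
-/

set_option autoImplicit false

noncomputable section

open MeasureTheory Filter Topology Real Function
open scoped Matrix ComplexConjugate BigOperators
open Literature.MathematicalPhysics.QuantumLattice
open Literature.MathematicalPhysics.QuantumFieldTheory hiding SU2
open Summit.QuantumFields.YangMills.Theorems

namespace Summit.QuantumFields.YangMills.Theorems.FemtoTransferGap.TT

open Summit.QuantumFields.YangMills.Theorems.FemtoTransferGap

variable {L : ℕ} [NeZero L]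

/-! ## §1 The closed ring of `n+1` bond kernels: measurability, bounds, slice weights -/

/-- The closed ring `(∏_{i<n} K_β(U_i,U_{i+1})) · K_β^P(U_n, U_0)` is measurable on the slice space. [folklore] -/
theorem measurable_ringChain (β : ℝ) (n : ℕ) :
    Measurable fun Us : Fin (n + 1) → GaugeConfig 3 L SU2 =>
      (∏ i : Fin n, transferKernel su2Rep β (Us i.castSucc) (Us i.succ)) *
        physAvg (transferKernel su2Rep β (Us (Fin.last n))) (Us 0) := by
  have hp : Measurable fun Us : Fin (n + 1) → GaugeConfig 3 L SU2 =>
      ∏ i : Fin n, transferKernel su2Rep β (Us i.castSucc) (Us i.succ) :=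
    Finset.measurable_prod _ fun i _ => measurable_transferKernel_slices β n i.castSucc i.succ
  exact hp.mul (measurable_physKernel_slices β n)

/-- The closed ring is non-negative. [folklore] -/
theorem ringChain_nonneg (β : ℝ) (n : ℕ) (Us : Fin (n + 1) → GaugeConfig 3 L SU2) :
    0 ≤ (∏ i : Fin n, transferKernel su2Rep β (Us i.castSucc) (Us i.succ)) *
        physAvg (transferKernel su2Rep β (Us (Fin.last n))) (Us 0) :=
  mul_nonneg (Finset.prod_nonneg fun _ _ => (transferKernel_pos _ _ _ _).le) (physAvg_nonneg (fun V => (transferKernel_pos _ _ _ V).le) _)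

/-- The closed ring is bounded by `(e^{2β|E|})^{n} · e^{2β|E|}` (`β ≥ 0`). [folklore] -/
theorem abs_ringChain_le {β : ℝ} (hβ : 0 ≤ β) (n : ℕ) (Us : Fin (n + 1) → GaugeConfig 3 L SU2) :
    |(∏ i : Fin n, transferKernel su2Rep β (Us i.castSucc) (Us i.succ)) *
        physAvg (transferKernel su2Rep β (Us (Fin.last n))) (Us 0)| ≤
      (Real.exp (2 * β) ^ Fintype.card (Edge 3 L)) ^ n * Real.exp (2 * β) ^ Fintype.card (Edge 3 L) := by
  set M : ℝ := Real.exp (2 * β) ^ Fintype.card (Edge 3 L) with hM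
  have hKM : ∀ U V : GaugeConfig 3 L SU2, |transferKernel su2Rep β U V| ≤ M := fun U V => abs_transferKernel_le_lat hβ (U, V)
  rw [abs_mul, Finset.abs_prod]
  refine mul_le_mul ?_ (abs_physAvg_le (fun V => hKM _ V) _) (abs_nonneg _) (by positivity)
  calc ∏ i : Fin n, |transferKernel su2Rep β (Us i.castSucc) (Us i.succ)| ≤ ∏ _i : Fin n, M :=
        Finset.prod_le_prod (fun i _ => abs_nonneg _) fun i _ => hKM _ _
    _ = M ^ n := by rw [Finset.prod_const, Finset.card_univ, Fintype.card_fin]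

/-- The ring times a bounded measurable function of the slices is integrable. [folklore] -/
theorem integrable_ringChain_mul {β : ℝ} (hβ : 0 ≤ β) (n : ℕ) {g : (Fin (n + 1) → GaugeConfig 3 L SU2) → ℝ} (hg : Measurable g)
    {C : ℝ} (hgb : ∀ Us, |g Us| ≤ C) :
    Integrable (fun Us : Fin (n + 1) → GaugeConfig 3 L SU2 =>
      (∏ i : Fin n, transferKernel su2Rep β (Us i.castSucc) (Us i.succ)) *
        physAvg (transferKernel su2Rep β (Us (Fin.last n))) (Us 0) * g Us)
      (Measure.pi fun _ : Fin (n + 1) => configMeasure SU2 L) := by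
  have hC : 0 ≤ C := (abs_nonneg _).trans (hgb fun _ => 1)
  refine integrable_of_measurable_abs_le _ ((measurable_ringChain β n).mul hg)
    (C := (Real.exp (2 * β) ^ Fintype.card (Edge 3 L)) ^ n * Real.exp (2 * β) ^ Fintype.card (Edge 3 L) * C) fun Us => ?_
  rw [abs_mul]
  exact mul_le_mul (abs_ringChain_le hβ n Us) (hgb Us) (abs_nonneg _) (by positivity)

/-- An indicator is bounded by `1` in absolute value. [folklore] -/
theorem abs_indicator_one_le {α : Type*} (S : Set α) (x : α) : |S.indicator (fun _ => (1 : ℝ)) x| ≤ 1 := by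
  by_cases hx : x ∈ S
  · rw [Set.indicator_of_mem hx, abs_one]
  · rw [Set.indicator_of_notMem hx, abs_zero]; exact zero_le_one

/-- The ring times the indicator of a measurable slice-`0` event is integrable. [folklore] -/
theorem integrable_ringChain_mul_indicator {β : ℝ} (hβ : 0 ≤ β) (n : ℕ) {A : Set (GaugeConfig 3 L SU2)} (hA : MeasurableSet A) :
    Integrable (fun Us : Fin (n + 1) → GaugeConfig 3 L SU2 =>
      (∏ i : Fin n, transferKernel su2Rep β (Us i.castSucc) (Us i.succ)) *
        physAvg (transferKernel su2Rep β (Us (Fin.last n))) (Us 0) * A.indicator (fun _ => (1 : ℝ)) (Us 0))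
      (Measure.pi fun _ : Fin (n + 1) => configMeasure SU2 L) :=
  integrable_ringChain_mul hβ n (g := fun Us => A.indicator (fun _ => (1 : ℝ)) (Us 0))
    ((measurable_const.indicator hA).comp (measurable_pi_apply 0)) fun _ => abs_indicator_one_le A _

/-- `ringInsTrace L β n O 0 = ∫ ring · O(U_0)²` (the slot `0` is slice `0`). [cite: MontvayMunster1994, (3.145)] -/
theorem ringInsTrace_zero_eq (β : ℝ) (n : ℕ) (O : GaugeConfig 3 L SU2 → ℝ) :
    ringInsTrace L β n O 0 =
      ∫ Us : Fin (n + 1) → GaugeConfig 3 L SU2,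
        (∏ i : Fin n, transferKernel su2Rep β (Us i.castSucc) (Us i.succ)) *
          physAvg (transferKernel su2Rep β (Us (Fin.last n))) (Us 0) * (O (Us 0) * O (Us 0))
        ∂(Measure.pi fun _ : Fin (n + 1) => configMeasure SU2 L) := by
  unfold ringInsTrace
  refine integral_congr_ae (ae_of_all _ fun Us => ?_)
  have h0 : (⟨0 % (n + 1), Nat.mod_lt _ (Nat.succ_pos _)⟩ : Fin (n + 1)) = 0 := Fin.ext (Nat.zero_mod _)
  dsimp only
  rw [h0]

/-- `ringInsTrace L β n (𝟙_A) 0 = ∫ ring · 𝟙_A(U_0)` — the un-normalised thermal weight of the slice-`0` event `A` at temperature `1/(n+1)`.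
[cite: MontvayMunster1994, (3.145)] -/
theorem ringInsTrace_indicator_zero (β : ℝ) (n : ℕ) (A : Set (GaugeConfig 3 L SU2)) :
    ringInsTrace L β n (A.indicator fun _ => (1 : ℝ)) 0 =
      ∫ Us : Fin (n + 1) → GaugeConfig 3 L SU2,
        (∏ i : Fin n, transferKernel su2Rep β (Us i.castSucc) (Us i.succ)) *
          physAvg (transferKernel su2Rep β (Us (Fin.last n))) (Us 0) * A.indicator (fun _ => (1 : ℝ)) (Us 0)
        ∂(Measure.pi fun _ : Fin (n + 1) => configMeasure SU2 L) := by
  rw [ringInsTrace_zero_eq]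
  refine integral_congr_ae (ae_of_all _ fun Us => ?_)
  dsimp only
  by_cases hU : Us 0 ∈ A
  · rw [Set.indicator_of_mem hU, mul_one]
  · rw [Set.indicator_of_notMem hU, mul_zero]

/-- The slice-`0` weight of an event is non-negative. [folklore] -/
theorem ringInsTrace_indicator_zero_nonneg (β : ℝ) (n : ℕ) (A : Set (GaugeConfig 3 L SU2)) :
    0 ≤ ringInsTrace L β n (A.indicator fun _ => (1 : ℝ)) 0 := by
  rw [ringInsTrace_indicator_zero]
  exact integral_nonneg fun Us => mul_nonneg (ringChain_nonneg β n Us) (Set.indicator_nonneg (fun _ _ => zero_le_one) _)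

/-- Monotonicity of the slice-`0` thermal weight in the event. [folklore] -/
theorem ringInsTrace_indicator_zero_mono {β : ℝ} (hβ : 0 ≤ β) (n : ℕ) {A B : Set (GaugeConfig 3 L SU2)} (hA : MeasurableSet A)
    (hB : MeasurableSet B) (hAB : A ⊆ B) :
    ringInsTrace L β n (A.indicator fun _ => (1 : ℝ)) 0 ≤ ringInsTrace L β n (B.indicator fun _ => (1 : ℝ)) 0 := by
  rw [ringInsTrace_indicator_zero, ringInsTrace_indicator_zero]
  refine integral_mono (integrable_ringChain_mul_indicator hβ n hA)
    (integrable_ringChain_mul_indicator hβ n hB) fun Us => ?_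
  refine mul_le_mul_of_nonneg_left ?_ (ringChain_nonneg β n Us)
  exact Set.indicator_le_indicator_of_subset hAB (fun _ => zero_le_one) _

/-- Subadditivity of the slice-`0` thermal weight: `weight(A ∪ B) ≤ weight(A) + weight(B)`. [folklore] -/
theorem ringInsTrace_indicator_zero_union_le {β : ℝ} (hβ : 0 ≤ β) (n : ℕ) {A B : Set (GaugeConfig 3 L SU2)} (hA : MeasurableSet A)
    (hB : MeasurableSet B) :
    ringInsTrace L β n ((A ∪ B).indicator fun _ => (1 : ℝ)) 0 ≤
      ringInsTrace L β n (A.indicator fun _ => (1 : ℝ)) 0 + ringInsTrace L β n (B.indicator fun _ => (1 : ℝ)) 0 := by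
  rw [ringInsTrace_indicator_zero, ringInsTrace_indicator_zero, ringInsTrace_indicator_zero]
  have hIA := integrable_ringChain_mul_indicator hβ n hA
  have hIB := integrable_ringChain_mul_indicator hβ n hB
  have hIAB := integrable_ringChain_mul_indicator hβ n (hA.union hB)
  rw [← integral_add hIA hIB]
  refine integral_mono hIAB (hIA.add hIB) fun Us => ?_
  dsimp only
  rw [← mul_add]
  refine mul_le_mul_of_nonneg_left ?_ (ringChain_nonneg β n Us)
  have h := Set.indicator_union_add_inter_apply (fun _ => (1 : ℝ)) A B (Us 0)
  have h0 : 0 ≤ (A ∩ B).indicator (fun _ => (1 : ℝ)) (Us 0) := Set.indicator_nonneg (fun _ _ => zero_le_one) _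
  linarith

/-- Complement additivity of the slice-`0` thermal weight: `weight(A) + weight(Aᶜ) = Z_phys(n+1)`. [folklore] -/
theorem ringInsTrace_indicator_zero_add_compl {β : ℝ} (hβ : 0 ≤ β) (n : ℕ) {A : Set (GaugeConfig 3 L SU2)} (hA : MeasurableSet A) :
    ringInsTrace L β n (A.indicator fun _ => (1 : ℝ)) 0 + ringInsTrace L β n (Aᶜ.indicator fun _ => (1 : ℝ)) 0 = physTraceSucc L β n := by
  rw [ringInsTrace_indicator_zero, ringInsTrace_indicator_zero]
  have hIA := integrable_ringChain_mul_indicator hβ n hA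
  have hIB := integrable_ringChain_mul_indicator hβ n hA.compl
  rw [← integral_add hIA hIB]
  unfold physTraceSucc
  refine integral_congr_ae (ae_of_all _ fun Us => ?_)
  dsimp only
  rw [← mul_add, Set.indicator_self_add_compl_apply, mul_one]

/-- **Two-time weight ≤ one-time weight**: for any slot `m`, `ringInsTrace L β n 𝟙_A m ≤ ringInsTrace L β n 𝟙_A 0` (`𝟙_A(U₀)𝟙_A(U_m) ≤ 𝟙_A(U₀)` and the
ring is non-negative). [folklore] -/
theorem ringInsTrace_indicator_le_zero_slot {β : ℝ} (hβ : 0 ≤ β) (n : ℕ) {A : Set (GaugeConfig 3 L SU2)} (hA : MeasurableSet A) (m : ℕ) :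
    ringInsTrace L β n (A.indicator fun _ => (1 : ℝ)) m ≤ ringInsTrace L β n (A.indicator fun _ => (1 : ℝ)) 0 := by
  rw [ringInsTrace_indicator_zero]
  unfold ringInsTrace
  have hI0 := integrable_ringChain_mul_indicator hβ n hA
  have hIm : Integrable (fun Us : Fin (n + 1) → GaugeConfig 3 L SU2 =>
      (∏ i : Fin n, transferKernel su2Rep β (Us i.castSucc) (Us i.succ)) *
        physAvg (transferKernel su2Rep β (Us (Fin.last n))) (Us 0) *
        (A.indicator (fun _ => (1 : ℝ)) (Us 0) * A.indicator (fun _ => (1 : ℝ)) (Us ⟨m % (n + 1), Nat.mod_lt _ (Nat.succ_pos _)⟩)))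
      (Measure.pi fun _ : Fin (n + 1) => configMeasure SU2 L) := by
    refine integrable_ringChain_mul hβ n (((measurable_const.indicator hA).comp (measurable_pi_apply 0)).mul
      ((measurable_const.indicator hA).comp (measurable_pi_apply _))) (C := 1) fun Us => ?_
    rw [abs_mul]
    exact mul_le_one₀ (abs_indicator_one_le A _) (abs_nonneg _) (abs_indicator_one_le A _)
  refine integral_mono hIm hI0 fun Us => ?_
  refine mul_le_mul_of_nonneg_left ?_ (ringChain_nonneg β n Us)
  have h1 : A.indicator (fun _ => (1 : ℝ)) (Us ⟨m % (n + 1), Nat.mod_lt _ (Nat.succ_pos _)⟩) ≤ 1 :=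
    Set.indicator_le_self' (fun _ _ => zero_le_one) _
  have h0 : 0 ≤ A.indicator (fun _ => (1 : ℝ)) (Us 0) := Set.indicator_nonneg (fun _ _ => zero_le_one) _
  calc A.indicator (fun _ => (1 : ℝ)) (Us 0) * A.indicator (fun _ => (1 : ℝ)) (Us ⟨m % (n + 1), Nat.mod_lt _ (Nat.succ_pos _)⟩)
      ≤ A.indicator (fun _ => (1 : ℝ)) (Us 0) * 1 := mul_le_mul_of_nonneg_left h1 h0
    _ = A.indicator (fun _ => (1 : ℝ)) (Us 0) := mul_one _

/-! ## §2 The one-step persistence bound along the ring -/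

omit [NeZero L] in
/-- The one-step slot of `ringInsTrace … 1` is the slice `1` (`n ≥ 1`). [folklore] -/
theorem fin_one_mod_succ_eq {n : ℕ} (hn : 1 ≤ n) :
    (⟨1 % (n + 1), Nat.mod_lt _ (Nat.succ_pos _)⟩ : Fin (n + 1)) = (⟨0, by omega⟩ : Fin n).succ := by
  apply Fin.ext
  simp only [Fin.val_succ]
  exact Nat.mod_eq_of_lt (by omega)

/-- ★ **Persistence bound along the ring.**  Let `O` be measurable with `|O| ≤ 1`, `A` a measurable slice event and `t ≥ 0`, and suppose the pointwise
persistence inequality `O(U)O(V) ≥ 1 − 2·𝟙_A(U) − 2·𝟙[∃ e, ‖U_e − V_e‖_F > t]`.  Then for `β ≥ 0`, `n ≥ 1`: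
`ringInsTrace L β n O 1 ≥ Z_phys(n+1) − 2·ringInsTrace L β n 𝟙_A 0 − 2·e^{β(2|E| − t²/2)}·(e^{2β|E|})^{n−1}·e^{2β|E|}`
(the far event costs one exponentially small bond, every other bond at most its supremum). [cite: MadrasSokal1988, §2] [cite: SeilerLNP1982, §3] -/
theorem ringInsTrace_one_ge_of_persistence {n : ℕ} (hn : 1 ≤ n) {β : ℝ} (hβ : 0 ≤ β) {O : GaugeConfig 3 L SU2 → ℝ} (hOm : Measurable O)
    (hOb : ∀ U, |O U| ≤ 1) {A : Set (GaugeConfig 3 L SU2)} (hA : MeasurableSet A) {t : ℝ} (ht : 0 ≤ t)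
    (hpt : ∀ U V : GaugeConfig 3 L SU2,
      1 - 2 * A.indicator (fun _ => (1 : ℝ)) U -
          2 * Set.indicator {p : GaugeConfig 3 L SU2 × GaugeConfig 3 L SU2 |
              ∃ e, t < frobNorm ((p.1 e : Matrix (Fin 2) (Fin 2) ℂ) - (p.2 e : Matrix (Fin 2) (Fin 2) ℂ))} (fun _ => (1 : ℝ)) (U, V) ≤
        O U * O V) :
    physTraceSucc L β n - 2 * ringInsTrace L β n (A.indicator fun _ => (1 : ℝ)) 0 -
        2 * (Real.exp (β * (2 * (Fintype.card (Edge 3 L) : ℝ) - t ^ 2 / 2)) *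
          (Real.exp (2 * β) ^ Fintype.card (Edge 3 L)) ^ (n - 1) * Real.exp (2 * β) ^ Fintype.card (Edge 3 L)) ≤
      ringInsTrace L β n O 1 := by
  set E : ℕ := Fintype.card (Edge 3 L) with hE
  set M : ℝ := Real.exp (2 * β) ^ E with hM
  set η : ℝ := Real.exp (β * (2 * (E : ℝ) - t ^ 2 / 2)) with hη
  set D : Set (GaugeConfig 3 L SU2 × GaugeConfig 3 L SU2) :=
    {p | ∃ e, t < frobNorm ((p.1 e : Matrix (Fin 2) (Fin 2) ℂ) - (p.2 e : Matrix (Fin 2) (Fin 2) ℂ))} with hDdef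
  set μ : Measure (Fin (n + 1) → GaugeConfig 3 L SU2) := Measure.pi fun _ => configMeasure SU2 L with hμ
  set F : (Fin (n + 1) → GaugeConfig 3 L SU2) → ℝ := fun Us =>
    (∏ i : Fin n, transferKernel su2Rep β (Us i.castSucc) (Us i.succ)) *
      physAvg (transferKernel su2Rep β (Us (Fin.last n))) (Us 0) with hF
  have hFm : Measurable F := measurable_ringChain β n
  have hF0 : ∀ Us, 0 ≤ F Us := ringChain_nonneg β n
  have hFb : ∀ Us, |F Us| ≤ M ^ n * M := abs_ringChain_le hβ n
  have hM0 : 0 ≤ M := by positivity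
  have hKM : ∀ U V : GaugeConfig 3 L SU2, transferKernel su2Rep β U V ≤ M := fun U V =>
    (le_abs_self _).trans (abs_transferKernel_le_lat hβ (U, V))
  have hPM : ∀ U V : GaugeConfig 3 L SU2, physAvg (transferKernel su2Rep β U) V ≤ M := fun U V =>
    (le_abs_self _).trans (abs_physAvg_le (fun W => abs_transferKernel_le_lat hβ (U, W)) V)
  -- the slot indices
  set i₀ : Fin n := ⟨0, by omega⟩ with hi₀
  have hcast : i₀.castSucc = (0 : Fin (n + 1)) := Fin.ext rfl
  have hslot : (⟨1 % (n + 1), Nat.mod_lt _ (Nat.succ_pos _)⟩ : Fin (n + 1)) = i₀.succ := fin_one_mod_succ_eq hn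
  -- (a) the far event costs `η M^{n-1} M` pointwise
  have hfar : ∀ Us, F Us * D.indicator (fun _ => (1 : ℝ)) (Us 0, Us i₀.succ) ≤ η * M ^ (n - 1) * M := by
    intro Us
    have hsplit : (∏ i : Fin n, transferKernel su2Rep β (Us i.castSucc) (Us i.succ)) =
        transferKernel su2Rep β (Us 0) (Us i₀.succ) *
          ∏ i ∈ Finset.univ.erase i₀, transferKernel su2Rep β (Us i.castSucc) (Us i.succ) := by
      rw [← Finset.mul_prod_erase Finset.univ _ (Finset.mem_univ i₀), hcast]
    have hrest : ∏ i ∈ Finset.univ.erase i₀, transferKernel su2Rep β (Us i.castSucc) (Us i.succ) ≤ M ^ (n - 1) := by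
      calc ∏ i ∈ Finset.univ.erase i₀, transferKernel su2Rep β (Us i.castSucc) (Us i.succ) ≤ ∏ _i ∈ Finset.univ.erase i₀, M :=
            Finset.prod_le_prod (fun i _ => (transferKernel_pos _ _ _ _).le) fun i _ => hKM _ _
        _ = M ^ (n - 1) := by
            rw [Finset.prod_const, Finset.card_erase_of_mem (Finset.mem_univ _), Finset.card_univ, Fintype.card_fin]
    have hrest0 : 0 ≤ ∏ i ∈ Finset.univ.erase i₀, transferKernel su2Rep β (Us i.castSucc) (Us i.succ) :=
      Finset.prod_nonneg fun i _ => (transferKernel_pos _ _ _ _).le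
    have hKD : transferKernel su2Rep β (Us 0) (Us i₀.succ) * D.indicator (fun _ => (1 : ℝ)) (Us 0, Us i₀.succ) ≤ η := by
      simpa only [hDdef, hη, hE] using FlatSheet.transferKernel_mul_indicator_far_le hβ ht (Us 0) (Us i₀.succ)
    have hP0 : 0 ≤ physAvg (transferKernel su2Rep β (Us (Fin.last n))) (Us 0) :=
      physAvg_nonneg (fun V => (transferKernel_pos _ _ _ V).le) _
    have hD0 : 0 ≤ D.indicator (fun _ => (1 : ℝ)) (Us 0, Us i₀.succ) := Set.indicator_nonneg (fun _ _ => zero_le_one) _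
    calc F Us * D.indicator (fun _ => (1 : ℝ)) (Us 0, Us i₀.succ)
        = (transferKernel su2Rep β (Us 0) (Us i₀.succ) * D.indicator (fun _ => (1 : ℝ)) (Us 0, Us i₀.succ)) *
            (∏ i ∈ Finset.univ.erase i₀, transferKernel su2Rep β (Us i.castSucc) (Us i.succ)) *
            physAvg (transferKernel su2Rep β (Us (Fin.last n))) (Us 0) := by
          simp only [hF]; rw [hsplit]; ring
      _ ≤ η * M ^ (n - 1) * M := by
          refine mul_le_mul (mul_le_mul hKD hrest hrest0 (Real.exp_pos _).le) (hPM _ _) hP0 (by positivity)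
  -- (b) pointwise: `F·(O₀O₁) ≥ F − 2F·𝟙_A(U₀) − 2ηM^{n-1}M`
  have hpoint : ∀ Us, F Us - 2 * (F Us * A.indicator (fun _ => (1 : ℝ)) (Us 0)) - 2 * (η * M ^ (n - 1) * M) ≤
      F Us * (O (Us 0) * O (Us ⟨1 % (n + 1), Nat.mod_lt _ (Nat.succ_pos _)⟩)) := by
    intro Us
    rw [hslot]
    have h1 := mul_le_mul_of_nonneg_left (hpt (Us 0) (Us i₀.succ)) (hF0 Us)
    have h2 := hfar Us
    nlinarith [h1, h2]
  -- (c) integrate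
  have hIF : Integrable F μ := integrable_of_measurable_abs_le _ hFm hFb
  have hIA : Integrable (fun Us => F Us * A.indicator (fun _ => (1 : ℝ)) (Us 0)) μ :=
    integrable_ringChain_mul_indicator hβ n hA
  have hIO : Integrable (fun Us => F Us * (O (Us 0) * O (Us ⟨1 % (n + 1), Nat.mod_lt _ (Nat.succ_pos _)⟩))) μ := by
    refine integrable_ringChain_mul hβ n ((hOm.comp (measurable_pi_apply 0)).mul (hOm.comp (measurable_pi_apply _))) (C := 1) fun Us => ?_
    rw [abs_mul]
    exact mul_le_one₀ (hOb _) (abs_nonneg _) (hOb _)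
  haveI : IsProbabilityMeasure μ := by rw [hμ]; infer_instance
  have h12 : Integrable (fun Us => F Us - 2 * (F Us * A.indicator (fun _ => (1 : ℝ)) (Us 0))) μ := hIF.sub (hIA.const_mul 2)
  have h3 : Integrable (fun _ : Fin (n + 1) → GaugeConfig 3 L SU2 => 2 * (η * M ^ (n - 1) * M)) μ := integrable_const _
  have h123 : Integrable (fun Us => F Us - 2 * (F Us * A.indicator (fun _ => (1 : ℝ)) (Us 0)) - 2 * (η * M ^ (n - 1) * M)) μ := h12.sub h3
  have hint := integral_mono h123 hIO hpoint
  rw [integral_sub h12 h3, integral_sub hIF (hIA.const_mul 2), integral_const_mul, integral_const, smul_eq_mul, probReal_univ,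
    one_mul] at hint
  -- identify the three integrals
  have hZ : physTraceSucc L β n = ∫ Us, F Us ∂μ := by
    simp only [physTraceSucc, hF, hμ]
  have hS : ringInsTrace L β n (A.indicator fun _ => (1 : ℝ)) 0 = ∫ Us, F Us * A.indicator (fun _ => (1 : ℝ)) (Us 0) ∂μ :=
    ringInsTrace_indicator_zero β n A
  have hI : ringInsTrace L β n O 1 = ∫ Us, F Us * (O (Us 0) * O (Us ⟨1 % (n + 1), Nat.mod_lt _ (Nat.succ_pos _)⟩)) ∂μ := by
    simp only [ringInsTrace, hF, hμ]
  rw [hZ, hS, hI]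
  simpa only [hη, hM, hE] using hint

end Summit.QuantumFields.YangMills.Theorems.FemtoTransferGap.TT

end
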